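import Mathlib.Analysis.SpecialFunctions.Pow.Real
import HarnessLib

/-!
# Elementary bounds for normalised connected correlations `⟨FG⟩/Z − (⟨F⟩/Z)(⟨G⟩/Z)` — PROVED

Topic `Literature/Analysis/OperatorTheory`; real-arithmetic bookkeeping for transfer-operator
clustering theorems (`CyclicKernelClustering.lean`): if four un-normalised correlation integrals are
`I_FG, I_F, I_G, Z`, then
* the A-PRIORI bound `abs_div_sub_div_mul_div_le`: `|I_FG/Z − (I_F/Z)(I_G/Z)| ≤ 2 b_F b_G` when
  `|I_FG| ≤ b_F b_G Z`, `|I_F| ≤ b_F Z`, `|I_G| ≤ b_G Z`, `Z > 0`;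
* the PERTURBATIVE bound `abs_ratio_sub_ratio_mul_ratio_le` / `abs_div_sub_div_mul_div_le_of_approx`:
  if `I_FG = L a_F a_G + e₁`, `I_F = L a_F + e₂`, `I_G = L a_G + e₃`, `Z = L + e₄` with
  `|e₁| ≤ b_F b_G E`, `|e₂| ≤ b_F E₀`, `|e₃| ≤ b_G E`, `|e₄| ≤ E₀ ≤ E`, `E₀ ≤ L/2`, then the main terms
  cancel and `|I_FG/Z − (I_F/Z)(I_G/Z)| ≤ 16 b_F b_G (E/L) + 8 b_F b_G (E/L)²`.
Mathlib only; no definitions. [folklore]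
-/

namespace Literature.Analysis.OperatorTheory

section RealLemmas

/-- A-priori bound on a normalised connected correlation: if `|a| ≤ b_F b_G z`, `|b| ≤ b_F z`,
`|d| ≤ b_G z` and `z > 0` then `|a/z − (b/z)(d/z)| ≤ 2 b_F b_G`. [folklore] -/
theorem abs_div_sub_div_mul_div_le {a b d z bF bG : ℝ} (hz : 0 < z) (ha : |a| ≤ bF * bG * z)
    (hb : |b| ≤ bF * z) (hd : |d| ≤ bG * z) : |a / z - b / z * (d / z)| ≤ 2 * (bF * bG) := by
  have hbF : 0 ≤ bF := by
    have h0 : 0 * z ≤ bF * z := by rw [zero_mul]; exact (abs_nonneg b).trans hb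
    exact le_of_mul_le_mul_right h0 hz
  have h1 : |a / z| ≤ bF * bG := by
    rw [abs_div, abs_of_pos hz, div_le_iff₀ hz]; exact ha
  have h2 : |b / z| ≤ bF := by
    rw [abs_div, abs_of_pos hz, div_le_iff₀ hz]; exact hb
  have h3 : |d / z| ≤ bG := by
    rw [abs_div, abs_of_pos hz, div_le_iff₀ hz]; exact hd
  calc |a / z - b / z * (d / z)| ≤ |a / z| + |b / z * (d / z)| := abs_sub _ _
    _ = |a / z| + |b / z| * |d / z| := by rw [abs_mul]
    _ ≤ bF * bG + bF * bG := add_le_add h1 (mul_le_mul h2 h3 (abs_nonneg _) hbF)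
    _ = 2 * (bF * bG) := by ring

/-- **The perturbative bound on the normalised connected correlation.** If the four cyclic
integrals are `L a_F a_G + e₁`, `L a_F + e₂`, `L a_G + e₃`, `L + e₄` with `|e₁| ≤ b_F b_G E`,
`|e₂| ≤ b_F E₀`, `|e₃| ≤ b_G E`, `|e₄| ≤ E₀`, `E₀ ≤ E`, `E₀ ≤ L/2`, `|a_F| ≤ b_F`, `|a_G| ≤ b_G`, then
the connected ratio is at most `16 b_F b_G (E/L) + 8 b_F b_G (E/L)²` (the `L²` main terms cancel).
[folklore] -/
theorem abs_ratio_sub_ratio_mul_ratio_le {L E E₀ bF bG aF aG e₁ e₂ e₃ e₄ : ℝ} (hL : 0 < L)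
    (hE₀L : E₀ ≤ L / 2) (hE₀E : E₀ ≤ E) (hbF : 0 ≤ bF) (hbG : 0 ≤ bG) (haF : |aF| ≤ bF)
    (haG : |aG| ≤ bG) (h₁ : |e₁| ≤ bF * bG * E) (h₂ : |e₂| ≤ bF * E₀) (h₃ : |e₃| ≤ bG * E)
    (h₄ : |e₄| ≤ E₀) :
    |(L * aF * aG + e₁) / (L + e₄) - (L * aF + e₂) / (L + e₄) * ((L * aG + e₃) / (L + e₄))| ≤
      16 * (bF * bG) * (E / L) + 8 * (bF * bG) * (E / L) ^ 2 := by
  have hE₀ : 0 ≤ E₀ := (abs_nonneg _).trans h₄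
  have hE : 0 ≤ E := hE₀.trans hE₀E
  set Z := L + e₄ with hZ
  have hZL : L / 2 ≤ Z := by
    have := neg_abs_le e₄
    rw [hZ]; linarith
  have hZpos : 0 < Z := lt_of_lt_of_le (half_pos hL) hZL
  have hZ2 : L ^ 2 / 4 ≤ Z ^ 2 := by nlinarith
  have hnum : (L * aF * aG + e₁) / Z - (L * aF + e₂) / Z * ((L * aG + e₃) / Z) =
      (L * (aF * aG * e₄ + e₁ - aF * e₃ - aG * e₂) + (e₁ * e₄ - e₂ * e₃)) / Z ^ 2 := by
    have hZne : Z ≠ 0 := hZpos.ne'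
    field_simp
    rw [hZ]
    ring
  rw [hnum, abs_div, abs_of_pos (by positivity : (0 : ℝ) < Z ^ 2), div_le_iff₀ (by positivity)]
  -- bound the numerator
  have hN : |L * (aF * aG * e₄ + e₁ - aF * e₃ - aG * e₂) + (e₁ * e₄ - e₂ * e₃)| ≤
      4 * L * (bF * bG) * E + 2 * (bF * bG) * E ^ 2 := by
    have habs₁ : |aF * aG * e₄| ≤ bF * bG * E := by
      rw [abs_mul, abs_mul]
      calc |aF| * |aG| * |e₄| ≤ bF * bG * E₀ :=
            mul_le_mul (mul_le_mul haF haG (abs_nonneg _) hbF) h₄ (abs_nonneg _) (by positivity)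
        _ ≤ bF * bG * E := by gcongr
    have habs₂ : |aF * e₃| ≤ bF * bG * E := by
      rw [abs_mul]
      calc |aF| * |e₃| ≤ bF * (bG * E) := mul_le_mul haF h₃ (abs_nonneg _) hbF
        _ = bF * bG * E := by ring
    have habs₃ : |aG * e₂| ≤ bF * bG * E := by
      rw [abs_mul]
      calc |aG| * |e₂| ≤ bG * (bF * E₀) := mul_le_mul haG h₂ (abs_nonneg _) hbG
        _ ≤ bG * (bF * E) := by gcongr
        _ = bF * bG * E := by ring
    have habs₄ : |e₁ * e₄| ≤ (bF * bG) * E ^ 2 := by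
      rw [abs_mul]
      calc |e₁| * |e₄| ≤ (bF * bG * E) * E₀ := mul_le_mul h₁ h₄ (abs_nonneg _) (by positivity)
        _ ≤ (bF * bG * E) * E := by gcongr
        _ = (bF * bG) * E ^ 2 := by ring
    have habs₅ : |e₂ * e₃| ≤ (bF * bG) * E ^ 2 := by
      rw [abs_mul]
      calc |e₂| * |e₃| ≤ (bF * E₀) * (bG * E) := mul_le_mul h₂ h₃ (abs_nonneg _) (by positivity)
        _ ≤ (bF * E) * (bG * E) := by gcongr
        _ = (bF * bG) * E ^ 2 := by ring
    have hin : |aF * aG * e₄ + e₁ - aF * e₃ - aG * e₂| ≤ 4 * (bF * bG) * E := by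
      calc |aF * aG * e₄ + e₁ - aF * e₃ - aG * e₂|
          ≤ |aF * aG * e₄| + |e₁| + |aF * e₃| + |aG * e₂| := by
            refine (abs_sub _ _).trans ?_
            refine add_le_add ((abs_sub _ _).trans (add_le_add (abs_add_le _ _) le_rfl)) le_rfl
        _ ≤ bF * bG * E + bF * bG * E + bF * bG * E + bF * bG * E :=
            add_le_add (add_le_add (add_le_add habs₁ h₁) habs₂) habs₃
        _ = 4 * (bF * bG) * E := by ring
    calc |L * (aF * aG * e₄ + e₁ - aF * e₃ - aG * e₂) + (e₁ * e₄ - e₂ * e₃)|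
        ≤ |L * (aF * aG * e₄ + e₁ - aF * e₃ - aG * e₂)| + |e₁ * e₄ - e₂ * e₃| := abs_add_le _ _
      _ ≤ L * (4 * (bF * bG) * E) + ((bF * bG) * E ^ 2 + (bF * bG) * E ^ 2) := by
          refine add_le_add ?_ ((abs_sub _ _).trans (add_le_add habs₄ habs₅))
          rw [abs_mul, abs_of_pos hL]
          exact mul_le_mul_of_nonneg_left hin hL.le
      _ = 4 * L * (bF * bG) * E + 2 * (bF * bG) * E ^ 2 := by ring
  refine hN.trans ?_
  -- compare with the right-hand side times `Z²`
  have hcoef : 0 ≤ 16 * (bF * bG) * (E / L) + 8 * (bF * bG) * (E / L) ^ 2 := by positivity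
  calc 4 * L * (bF * bG) * E + 2 * (bF * bG) * E ^ 2
      = (16 * (bF * bG) * (E / L) + 8 * (bF * bG) * (E / L) ^ 2) * (L ^ 2 / 4) := by
        field_simp
        ring
    _ ≤ (16 * (bF * bG) * (E / L) + 8 * (bF * bG) * (E / L) ^ 2) * Z ^ 2 :=
        mul_le_mul_of_nonneg_left hZ2 hcoef

/-- `abs_ratio_sub_ratio_mul_ratio_le` with the four integrals as the variables. [folklore] -/
theorem abs_div_sub_div_mul_div_le_of_approx {L E E₀ bF bG aF aG IFG IF1 I1G Z : ℝ} (hL : 0 < L)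
    (hE₀L : E₀ ≤ L / 2) (hE₀E : E₀ ≤ E) (hbF : 0 ≤ bF) (hbG : 0 ≤ bG) (haF : |aF| ≤ bF)
    (haG : |aG| ≤ bG) (h₁ : |IFG - L * aF * aG| ≤ bF * bG * E) (h₂ : |IF1 - L * aF| ≤ bF * E₀)
    (h₃ : |I1G - L * aG| ≤ bG * E) (h₄ : |Z - L| ≤ E₀) :
    |IFG / Z - IF1 / Z * (I1G / Z)| ≤ 16 * (bF * bG) * (E / L) + 8 * (bF * bG) * (E / L) ^ 2 := by
  have key := abs_ratio_sub_ratio_mul_ratio_le (e₁ := IFG - L * aF * aG) (e₂ := IF1 - L * aF)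
    (e₃ := I1G - L * aG) (e₄ := Z - L) hL hE₀L hE₀E hbF hbG haF haG h₁ h₂ h₃ h₄
  have eq1 : L * aF * aG + (IFG - L * aF * aG) = IFG := by ring
  have eq2 : L * aF + (IF1 - L * aF) = IF1 := by ring
  have eq3 : L * aG + (I1G - L * aG) = I1G := by ring
  have eq4 : L + (Z - L) = Z := by ring
  rw [eq1, eq2, eq3, eq4] at key
  exact key

end RealLemmas

end Literature.Analysis.OperatorTheory
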